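import Mathlib
import HarnessLib
import Literature.MathematicalPhysics.QuantumLattice.HubbardCovarianceCTNormalForm
import Summits.HubbardSuperconductivity.HubbardSuperconductivity.Theorems.KLProgrammeKLRegimeWickScaleFlowLines

/-!
# Route `KLProgramme` — crux K3, ENGINE child (stmt-HubbardSuperconductivity-20236 `KLRegimeEngineV16` / its gen-7-flow successor), stub
# `stub_engine_step_values`, conjunct (E2-v10): the DRESSED partial-slice covariance family of organisation (R1′) and its scale derivative

Cell gate-hubbard-kl, seat hubbard-kl-p1 (g10; (E2) Wick-toolkit lane).  Under (R1′) (E2-SIGMA-DRESSING, evidence #28 on 20236; plan g16 (R25)(3):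
common row of both schemes) the two-leg part of the scale-`(n−1)` input action, a diagonal vertex with symbol `κ` (`2·kernel 𝒱 2 (ψ̂⁺,ψ̂⁻)`,
`…WickDressedLines`), is resummed into the step covariance: the partial slice `C^K_{(Λ, Λ₀]} = normalCovariance s_Λ`
(`hubbardCovSliceCT_zero_seed`: `s_Λ(k,σ) = (w^K_Λ(k) − w^K_{Λ₀}(k))·βL²·(iω+e_K)/nambuDen`) becomes the DRESSED normal covariance
`normalCovariance (s_Λ/(1 + s_Λ·κ))` (`effAction_normalCovariance_add_diagQuadratic`, p521577).  The continuous (E2) organisation (k3c1-p1,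
`klws_hasDerivAt_kernel_wickCarrier` — generic in a `C¹` covariance family) needs this family's FLOW DATA along `Λ ∈ [Λ_n, Λ_{n−1}]`; here it is:

* §1 (generic) `hasDerivAt_normalCovariance_apply` — a normal-covariance family is differentiated SYMBOL-WISE (each entry is `±d_t(k,σ)` or `0`);
  `hasDerivAt_dressSymbol` — the quotient rule `∂_t [s/(1 + sκ)] = ṡ/(1 + sκ)²`;
* §2 (model) `klws_hasDerivAt_sliceSymbol` — `∂_Λ s_Λ(k,σ) = ẇ^K_Λ(k)·βL²·(iω+e_K)/nambuDen` (`klws_hasDerivAt_cutoffWeight_scale`);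
  **`klws_hasDerivAt_dressedSliceCov`** — for every `κ` with `1 + s_Λκ ≠ 0`:
  `∂_Λ normalCovariance (s_Λ/(1+s_Λκ)) (X,Y) = normalCovariance (ẇ_Λ·βL²(iω+e_K)/nambuDen / (1 + s_Λκ)²) (X,Y)` — the dressed derivative line is
  again a NORMAL (diagonal) covariance, so the channel identities read it through `diagContr` (`contr_normalCovariance_eq_diagContr`,
  …WickDressedLines) exactly as they read the bare `Ċ_Λ` (`klws_contr_derivHardCov_eq_diagContr`);
  `klws_sliceCov_eq_normalCovariance_sliceSymbol` — the undressed identification (restated from `hubbardCovSliceCT_zero_seed`).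

Exact calculus; nothing about sizes or superconductivity is asserted.  0 kit.
-/

noncomputable section

namespace Summit.HubbardSuperconductivity.HubbardSuperconductivity.Theorems.KLRegimeWick

set_option linter.dupNamespace false -- summit = problem name (single-conjunct summit), D-0017

open Literature.MathematicalPhysics.QuantumLattice GrassmannAlgebra Finset Matrix
open Literature.Probability.LatticeModels

/-! ## §1 Generic: normal-covariance families are differentiated symbol-wise; the dressing quotient rule -/

section Generic

variable {L M : ℕ}

/-- **A normal-covariance family is differentiated symbol-wise**: if `t ↦ d_t(k,σ)` has derivative `d′(k,σ)` at `t` for every `(k,σ)`, then every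
entry of `t ↦ normalCovariance d_t` has derivative the corresponding entry of `normalCovariance d′`. -/
theorem hasDerivAt_normalCovariance_apply {d : ℝ → FreqMomentum L M × Fin 2 → ℂ} {d' : FreqMomentum L M × Fin 2 → ℂ} {t : ℝ}
    (h : ∀ ks, HasDerivAt (fun t' => d t' ks) (d' ks) t) (X Y : HubbardFieldIdx L M) :
    HasDerivAt (fun t' => normalCovariance L M (d t') X Y) (normalCovariance L M d' X Y) t := by
  simp only [normalCovariance_apply]
  by_cases h1 : X.1 = Y.1
  · simp only [if_pos h1]
    by_cases h2 : X.2 = 0 ∧ Y.2 = 1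
    · simp only [if_pos h2]; exact h X.1
    · simp only [if_neg h2]
      by_cases h3 : X.2 = 1 ∧ Y.2 = 0
      · simp only [if_pos h3]; exact (h X.1).neg
      · simp only [if_neg h3]; exact hasDerivAt_const t (0 : ℂ)
  · simp only [if_neg h1]; exact hasDerivAt_const t (0 : ℂ)

/-- **The dressing quotient rule**: `∂_t [s/(1 + s·κ)] = ṡ/(1 + s·κ)²` where `1 + s(t)κ ≠ 0`. -/
theorem hasDerivAt_dressSymbol {s : ℝ → ℂ} {s' κ : ℂ} {t : ℝ} (h : HasDerivAt s s' t) (hden : 1 + s t * κ ≠ 0) :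
    HasDerivAt (fun t' => s t' / (1 + s t' * κ)) (s' / (1 + s t * κ) ^ 2) t := by
  have hD : HasDerivAt (fun t' => 1 + s t' * κ) (s' * κ) t := by
    simpa using (h.mul_const κ).const_add 1
  have hq := h.div hD hden
  refine hq.congr_deriv ?_
  field_simp
  ring

end Generic

/-! ## §2 Model: the dressed partial-slice family and its scale derivative -/

section Model

variable (L M : ℕ) [NeZero L] (β μ : ℝ) (K : TrigPolyC4v)

/-- **The partial slice is the normal covariance of its symbol** `s_Λ(k,σ) = (w^K_Λ(k) − w^K_{Λ₀}(k))·βL²·(iω+e_K)/nambuDen`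
(`hubbardCovSliceCT_zero_seed`, restated with the moving cutoff first). -/
theorem klws_sliceCov_eq_normalCovariance_sliceSymbol (Λ Λ₀ : ℝ) :
    hubbardCovSliceCT L M β μ 0 K Λ Λ₀ = normalCovariance L M (fun ks =>
      ((hubbardCutoffWeightCT L M β μ K Λ ks.1 : ℂ) - (hubbardCutoffWeightCT L M β μ K Λ₀ ks.1 : ℂ)) *
        (((β * (L : ℝ) ^ 2 : ℝ) : ℂ) * ((Complex.I * matsubaraFreq β M ks.1.1 + nambuXiCT L μ K ks.1.2) / nambuDenCT L M β μ 0 K ks.1))) :=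
  hubbardCovSliceCT_zero_seed β μ K Λ Λ₀

omit [NeZero L] in
/-- **The scale derivative of the partial-slice symbol**: `∂_Λ s_Λ(k,σ) = ẇ^K_Λ(k)·βL²·(iω+e_K)/nambuDen` (`Λ ≠ 0`; the top `Λ₀` is fixed). -/
theorem klws_hasDerivAt_sliceSymbol {Λ : ℝ} (hΛ : Λ ≠ 0) (Λ₀ : ℝ) (ks : FreqMomentum L M × Fin 2) :
    HasDerivAt (fun Λ' : ℝ =>
        ((hubbardCutoffWeightCT L M β μ K Λ' ks.1 : ℂ) - (hubbardCutoffWeightCT L M β μ K Λ₀ ks.1 : ℂ)) *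
          (((β * (L : ℝ) ^ 2 : ℝ) : ℂ) * ((Complex.I * matsubaraFreq β M ks.1.1 + nambuXiCT L μ K ks.1.2) / nambuDenCT L M β μ 0 K ks.1)))
      (((deriv (fun Λ' : ℝ => hubbardCutoffWeightCT L M β μ K Λ' ks.1) Λ : ℝ) : ℂ) *
          (((β * (L : ℝ) ^ 2 : ℝ) : ℂ) * ((Complex.I * matsubaraFreq β M ks.1.1 + nambuXiCT L μ K ks.1.2) / nambuDenCT L M β μ 0 K ks.1)))
      Λ := by
  have hw := (klws_hasDerivAt_cutoffWeight_scale L M β μ K hΛ ks.1)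
  have hwC : HasDerivAt (fun Λ' : ℝ => ((hubbardCutoffWeightCT L M β μ K Λ' ks.1 : ℝ) : ℂ))
      (((deriv (fun Λ' : ℝ => hubbardCutoffWeightCT L M β μ K Λ' ks.1) Λ : ℝ) : ℂ)) Λ := by
    rw [hw.deriv]
    exact hw.ofReal_comp
  have hsub := hwC.sub_const ((hubbardCutoffWeightCT L M β μ K Λ₀ ks.1 : ℂ))
  exact hsub.mul_const _

omit [NeZero L] in
/-- **The dressed partial-slice family is differentiable along the slice, with a NORMAL derivative**: for every symbol `κ` with
`1 + s_Λ(k,σ)·κ(k,σ) ≠ 0`, every entry of `Λ ↦ normalCovariance (s_Λ/(1 + s_Λκ))` has derivative the corresponding entry of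
`normalCovariance (∂_Λ s_Λ / (1 + s_Λκ)²)` — the dressed twin of the derivative line `Ċ_Λ` of the continuous (E2) organisation, diagonal like it. -/
theorem klws_hasDerivAt_dressedSliceCov {Λ : ℝ} (hΛ : Λ ≠ 0) (Λ₀ : ℝ) (κ : FreqMomentum L M × Fin 2 → ℂ)
    (hden : ∀ ks : FreqMomentum L M × Fin 2,
      1 + ((hubbardCutoffWeightCT L M β μ K Λ ks.1 : ℂ) - (hubbardCutoffWeightCT L M β μ K Λ₀ ks.1 : ℂ)) *
          (((β * (L : ℝ) ^ 2 : ℝ) : ℂ) * ((Complex.I * matsubaraFreq β M ks.1.1 + nambuXiCT L μ K ks.1.2) / nambuDenCT L M β μ 0 K ks.1)) *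
        κ ks ≠ 0)
    (X Y : HubbardFieldIdx L M) :
    HasDerivAt (fun Λ' : ℝ => normalCovariance L M (fun ks =>
        ((hubbardCutoffWeightCT L M β μ K Λ' ks.1 : ℂ) - (hubbardCutoffWeightCT L M β μ K Λ₀ ks.1 : ℂ)) *
            (((β * (L : ℝ) ^ 2 : ℝ) : ℂ) * ((Complex.I * matsubaraFreq β M ks.1.1 + nambuXiCT L μ K ks.1.2) / nambuDenCT L M β μ 0 K ks.1)) /
          (1 + ((hubbardCutoffWeightCT L M β μ K Λ' ks.1 : ℂ) - (hubbardCutoffWeightCT L M β μ K Λ₀ ks.1 : ℂ)) *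
            (((β * (L : ℝ) ^ 2 : ℝ) : ℂ) * ((Complex.I * matsubaraFreq β M ks.1.1 + nambuXiCT L μ K ks.1.2) / nambuDenCT L M β μ 0 K ks.1)) *
            κ ks)) X Y)
      (normalCovariance L M (fun ks =>
        (((deriv (fun Λ' : ℝ => hubbardCutoffWeightCT L M β μ K Λ' ks.1) Λ : ℝ) : ℂ) *
            (((β * (L : ℝ) ^ 2 : ℝ) : ℂ) * ((Complex.I * matsubaraFreq β M ks.1.1 + nambuXiCT L μ K ks.1.2) / nambuDenCT L M β μ 0 K ks.1))) /
          (1 + ((hubbardCutoffWeightCT L M β μ K Λ ks.1 : ℂ) - (hubbardCutoffWeightCT L M β μ K Λ₀ ks.1 : ℂ)) *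
            (((β * (L : ℝ) ^ 2 : ℝ) : ℂ) * ((Complex.I * matsubaraFreq β M ks.1.1 + nambuXiCT L μ K ks.1.2) / nambuDenCT L M β μ 0 K ks.1)) *
            κ ks) ^ 2) X Y) Λ :=
  hasDerivAt_normalCovariance_apply (fun ks => hasDerivAt_dressSymbol (klws_hasDerivAt_sliceSymbol L M β μ K hΛ Λ₀ ks) (hden ks)) X Y

end Model

end Summit.HubbardSuperconductivity.HubbardSuperconductivity.Theorems.KLRegimeWick

end
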